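import Summits.NavierStokesRegularity.NavierStokesRegularity.Theorems.RungBlowupCofinal.SolidHarmonicAnsatz
import Summits.NavierStokesRegularity.NavierStokesRegularity.Theorems.RungBlowupCofinal.SectoralToroidalWaves
import HarnessLib

/-!
# The sectoral wave class of rung `L`: for `ℓ(y) = y₀ + iy₁` the solid harmonics `Re ℓⁿ`, `Im ℓⁿ`
# are harmonic, homogeneous of degree `n` and a `K₂`-wave pair, so every three-profile field
# `a(‖x‖²)∇Re ℓⁿ + b(‖x‖²)(Re ℓⁿ)x + c(‖x‖²) x × ∇Re ℓⁿ` is band-limited of degree `n`, an `n`-fold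
# azimuthal wave, a `𝒞`-eigenfield `n(n+1)`, co-band-limited below `n`, and solenoidal under one ODE
# (route `AngularGalerkinLadder`, crux K1 `RungBlowupCofinal`; kinematic helper, theorems only)

Cell `ns-blowup`, seat `ns-blowup-circuit` (g11, AGL Lean seat). Helper file for
`stmt-NavierStokesRegularity-19959` serving the line `Cruxes/RungBlowupCofinal/Lines/qlwave.lean`:
the card (§1 «FOLD RANGE», §2 «FIRST RUNG = a radial BVP») reads a SECTORAL (`n = L`) mean–wave
witness as «THREE radial coefficient functions» for the wave `W`. This file types that class:
instantiating `SolidHarmonicAnsatz.lean` at the sectoral solid harmonics of `SectoralHarmonics.lean`.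
LABEL: KERNEL kinematics. Nothing here asserts a Theses declaration; no definition, no named fact.
WHAT THIS IS NOT: not Navier–Stokes evidence; not a mean–wave PROFILE — only the kinematic letters
(`IsBandLimited`, `IsAzimuthalWave`, `IsDivFree`, `IsCobandLimited`) of the three-profile sectoral
class; the zonal / wave EQUATIONS of `Qlwave.IsMeanWaveProfile` are untouched.

## Content

For a real-linear `ℓ : ℝ³ →L[ℝ] ℂ` with `Σ_i ℓ(e_i)² = 0` (isotropy; hypothesis `hiso`),
`ℓ(e₂ × y) = iℓ(y)` (`h2`) and `Σ_a ℓ(e_a × y)² = −ℓ(y)²` (`hs`) — all three hold for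
`ℓ(y) = y₀ + iy₁` (`sectoral_functional_laws`):

* §1 `fderiv_fderiv_clm_pow` (`D²ℓ^m(y)(v,w) = m(m−1)ℓ^{m−2}ℓ(v)ℓ(w)`), **`laplacian_re_clm_pow`** /
  `laplacian_im_clm_pow` (`Δ Re ℓ^m = Δ Im ℓ^m = 0` from isotropy), **`fderiv_re_clm_pow_self`** /
  `fderiv_im_clm_pow_self` (Euler homogeneity `D(Re ℓ^m)(y)y = m Re ℓ^m(y)`).
* §2 **the sectoral three-profile class** `U = a(‖x‖²)∇Re ℓⁿ + b(‖x‖²)(Re ℓⁿ)x + c(‖x‖²) x × ∇Re ℓⁿ`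
  (`a, b, c` smooth): `casimir_sectoralAnsatz` (`𝒞U = n(n+1)U`), **`isBandLimited_sectoralAnsatz`**
  (`L ≥ n`), **`wave_sectoralAnsatz`** (`J₃(J₃U) = −n²U`, the letter of `Qlwave.IsAzimuthalWave n U`),
  **`isCobandLimited_sectoralAnsatz`** (`L < n`), **`isDivFree_sectoralAnsatz`** (under
  `2n a′ + 2ρ b′ + (n+3) b = 0` on `ρ ≥ 0`); `sectoral_functional_laws` +
  **`exists_sectoralAnsatz_functional`** discharge the hypotheses for `ℓ(y) = y₀ + iy₁`.

With `SectoralToroidalWaves.exists_sectoral_toroidal_wave` (the member `a = b = 0`) the class is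
non-empty; by K5-74/K5-75 a sectoral band-limited `n = L` wave lies in the top isotype, which these
fields exhaust at the level of the classical vector-spherical-harmonic triple. [cite: BullardGellman1954]
(degree-`j` isotype = `f(r)∇(r^jY) ⊕ g(r)r^jY x̂ ⊕ h(r)x × ∇(r^jY)`; here projection-free).
-/

noncomputable section

namespace Summit.NavierStokesRegularity.AngularGalerkinLadderSectoralWaveAnsatz

open Set Function Complex
open scoped ContDiff RealInnerProductSpace Laplacian
open Literature.Analysis.FluidPDE
open Summit.NavierStokesRegularity.FluidComputer
open Summit.NavierStokesRegularity.FluidComputer.AngularLadder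
open Summit.NavierStokesRegularity.AngularGalerkinLadderSectoralHarmonics
open Summit.NavierStokesRegularity.AngularGalerkinLadderSolidHarmonicAnsatz

variable (ℓ : EuclideanSpace ℝ (Fin 3) →L[ℝ] ℂ) {a b c : ℝ → ℝ} {L n : ℕ}

/-! ## §1 The sectoral solid harmonics are harmonic and homogeneous -/

/-- `D²(ℓ^m)(y)(v)(w) = m(m−1) ℓ(y)^{m−2} ℓ(v) ℓ(w)`. [folklore] -/
theorem fderiv_fderiv_clm_pow (m : ℕ) (y v w : EuclideanSpace ℝ (Fin 3)) :
    fderiv ℝ (fun z => fderiv ℝ (fun x => (ℓ x) ^ m) z v) y w =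
      (m : ℂ) * ((m - 1 : ℕ) : ℂ) * (ℓ y) ^ (m - 1 - 1) * ℓ v * ℓ w := by
  have e : (fun z => fderiv ℝ (fun x => (ℓ x) ^ m) z v) = fun z => ((m : ℂ) * ℓ v) * (ℓ z) ^ (m - 1) := by
    funext z
    rw [fderiv_clm_pow_apply]
    ring
  rw [e, fderiv_const_mul ((differentiable_clm_pow ℓ (m - 1)) y), FunLike.coe_smul, Pi.smul_apply,
    smul_eq_mul, fderiv_clm_pow_apply]
  ring

/-- Second real derivatives commute with real parts. [folklore] -/
theorem fderiv_fderiv_re_clm_pow (m : ℕ) (y v w : EuclideanSpace ℝ (Fin 3)) :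
    fderiv ℝ (fun z => fderiv ℝ (fun x => ((ℓ x) ^ m).re) z v) y w =
      (fderiv ℝ (fun z => fderiv ℝ (fun x => (ℓ x) ^ m) z v) y w).re := by
  have e : (fun z => fderiv ℝ (fun x => ((ℓ x) ^ m).re) z v) =
      fun z => (fderiv ℝ (fun x => (ℓ x) ^ m) z v).re :=
    funext fun z => fderiv_re_apply ((differentiable_clm_pow ℓ m) z) v
  have hd : DifferentiableAt ℝ (fun z => fderiv ℝ (fun x => (ℓ x) ^ m) z v) y := by
    have e2 : (fun z => fderiv ℝ (fun x => (ℓ x) ^ m) z v) =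
        fun z => ((m : ℂ) * ℓ v) * (ℓ z) ^ (m - 1) := by
      funext z
      rw [fderiv_clm_pow_apply]
      ring
    rw [e2]
    exact (((differentiable_clm_pow ℓ (m - 1)) y).const_mul _)
  rw [e, fderiv_re_apply hd]

/-- Second real derivatives commute with imaginary parts. [folklore] -/
theorem fderiv_fderiv_im_clm_pow (m : ℕ) (y v w : EuclideanSpace ℝ (Fin 3)) :
    fderiv ℝ (fun z => fderiv ℝ (fun x => ((ℓ x) ^ m).im) z v) y w =
      (fderiv ℝ (fun z => fderiv ℝ (fun x => (ℓ x) ^ m) z v) y w).im := by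
  have e : (fun z => fderiv ℝ (fun x => ((ℓ x) ^ m).im) z v) =
      fun z => (fderiv ℝ (fun x => (ℓ x) ^ m) z v).im :=
    funext fun z => fderiv_im_apply ((differentiable_clm_pow ℓ m) z) v
  have hd : DifferentiableAt ℝ (fun z => fderiv ℝ (fun x => (ℓ x) ^ m) z v) y := by
    have e2 : (fun z => fderiv ℝ (fun x => (ℓ x) ^ m) z v) =
        fun z => ((m : ℂ) * ℓ v) * (ℓ z) ^ (m - 1) := by
      funext z
      rw [fderiv_clm_pow_apply]
      ring
    rw [e2]
    exact (((differentiable_clm_pow ℓ (m - 1)) y).const_mul _)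
  rw [e, fderiv_im_apply hd]

/-- The Laplacian on `ℝ³` as the sum of second derivatives along the axes. [folklore] -/
private theorem laplacian_eq_sum_axis' {φ : EuclideanSpace ℝ (Fin 3) → ℝ} (hφ : ContDiff ℝ ∞ φ)
    (y : EuclideanSpace ℝ (Fin 3)) :
    (Δ φ) y = ∑ i : Fin 3, fderiv ℝ (fun z => fderiv ℝ φ z (axis i)) y (axis i) := by
  rw [InnerProductSpace.laplacian_eq_iteratedFDeriv_orthonormalBasis φ
    (EuclideanSpace.basisFun (Fin 3) ℝ)]
  refine Finset.sum_congr rfl fun i _ => ?_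
  rw [iteratedFDeriv_two_apply, fderiv_fderiv_apply_const hφ]
  simp [axis]

/-- **The real sectoral harmonic is harmonic**: `Δ Re ℓ^m = 0` when `Σ_i ℓ(e_i)² = 0`
(`Δℓ^m = m(m−1)ℓ^{m−2} Σ_i ℓ(e_i)²`). [cite: BullardGellman1954] -/
theorem laplacian_re_clm_pow (hiso : ∑ i : Fin 3, (ℓ (axis i)) ^ 2 = 0) (m : ℕ)
    (y : EuclideanSpace ℝ (Fin 3)) : (Δ fun x => ((ℓ x) ^ m).re) y = 0 := by
  rw [laplacian_eq_sum_axis' (contDiff_re_clm_pow ℓ m)]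
  simp only [fderiv_fderiv_re_clm_pow, fderiv_fderiv_clm_pow, ← Complex.re_sum]
  rw [show ∑ i : Fin 3, (m : ℂ) * ((m - 1 : ℕ) : ℂ) * (ℓ y) ^ (m - 1 - 1) * ℓ (axis i) * ℓ (axis i) =
      (m : ℂ) * ((m - 1 : ℕ) : ℂ) * (ℓ y) ^ (m - 1 - 1) * ∑ i : Fin 3, (ℓ (axis i)) ^ 2 by
    rw [Finset.mul_sum]; exact Finset.sum_congr rfl fun i _ => by ring, hiso, mul_zero,
    Complex.zero_re]

/-- **The imaginary sectoral harmonic is harmonic**: `Δ Im ℓ^m = 0`. [cite: BullardGellman1954] -/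
theorem laplacian_im_clm_pow (hiso : ∑ i : Fin 3, (ℓ (axis i)) ^ 2 = 0) (m : ℕ)
    (y : EuclideanSpace ℝ (Fin 3)) : (Δ fun x => ((ℓ x) ^ m).im) y = 0 := by
  rw [laplacian_eq_sum_axis' (contDiff_im_clm_pow ℓ m)]
  simp only [fderiv_fderiv_im_clm_pow, fderiv_fderiv_clm_pow, ← Complex.im_sum]
  rw [show ∑ i : Fin 3, (m : ℂ) * ((m - 1 : ℕ) : ℂ) * (ℓ y) ^ (m - 1 - 1) * ℓ (axis i) * ℓ (axis i) =
      (m : ℂ) * ((m - 1 : ℕ) : ℂ) * (ℓ y) ^ (m - 1 - 1) * ∑ i : Fin 3, (ℓ (axis i)) ^ 2 by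
    rw [Finset.mul_sum]; exact Finset.sum_congr rfl fun i _ => by ring, hiso, mul_zero,
    Complex.zero_im]

/-- Euler homogeneity of the complex sectoral harmonic: `D(ℓ^m)(y) y = m ℓ(y)^m`. [folklore] -/
theorem fderiv_clm_pow_self (m : ℕ) (y : EuclideanSpace ℝ (Fin 3)) :
    fderiv ℝ (fun x => (ℓ x) ^ m) y y = (m : ℂ) * (ℓ y) ^ m := by
  rw [fderiv_clm_pow_apply]
  rcases m with _ | k
  · simp
  · simp only [Nat.add_sub_cancel, pow_succ]
    ring

/-- **Euler homogeneity of `Re ℓ^m`**: `D(Re ℓ^m)(y) y = m · Re ℓ^m(y)`. [folklore] -/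
theorem fderiv_re_clm_pow_self (m : ℕ) (y : EuclideanSpace ℝ (Fin 3)) :
    fderiv ℝ (fun x => ((ℓ x) ^ m).re) y y = (m : ℝ) * ((ℓ y) ^ m).re := by
  rw [fderiv_re_apply ((differentiable_clm_pow ℓ m) y), fderiv_clm_pow_self]
  simp

/-- **Euler homogeneity of `Im ℓ^m`**. [folklore] -/
theorem fderiv_im_clm_pow_self (m : ℕ) (y : EuclideanSpace ℝ (Fin 3)) :
    fderiv ℝ (fun x => ((ℓ x) ^ m).im) y y = (m : ℝ) * ((ℓ y) ^ m).im := by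
  rw [fderiv_im_apply ((differentiable_clm_pow ℓ m) y), fderiv_clm_pow_self]
  simp

/-! ## §2 The sectoral three-profile class -/

/-- **`𝒞U = n(n+1)U`** for the sectoral three-profile field. [cite: BullardGellman1954] -/
theorem casimir_sectoralAnsatz (hiso : ∑ i : Fin 3, (ℓ (axis i)) ^ 2 = 0)
    (ha : ContDiff ℝ ∞ a) (hb : ContDiff ℝ ∞ b) (hc : ContDiff ℝ ∞ c) :
    casimir (fun x : EuclideanSpace ℝ (Fin 3) =>
      a (‖x‖ ^ 2) • gradient (fun z => ((ℓ z) ^ n).re) x +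
        b (‖x‖ ^ 2) • (((ℓ x) ^ n).re • x) +
        c (‖x‖ ^ 2) • cross x (gradient (fun z => ((ℓ z) ^ n).re) x)) =
      ((n : ℝ) * ((n : ℝ) + 1)) • fun x : EuclideanSpace ℝ (Fin 3) =>
        a (‖x‖ ^ 2) • gradient (fun z => ((ℓ z) ^ n).re) x +
          b (‖x‖ ^ 2) • (((ℓ x) ^ n).re • x) +
          c (‖x‖ ^ 2) • cross x (gradient (fun z => ((ℓ z) ^ n).re) x) :=
  casimir_threeLift ha hb hc (contDiff_re_clm_pow ℓ n) (laplacian_re_clm_pow ℓ hiso n)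
    (fderiv_re_clm_pow_self ℓ n)

/-- **The sectoral three-profile field is band-limited of every degree `L ≥ n`** (letter
`IsBandLimited L W`). [cite: BullardGellman1954] -/
theorem isBandLimited_sectoralAnsatz (hiso : ∑ i : Fin 3, (ℓ (axis i)) ^ 2 = 0)
    (ha : ContDiff ℝ ∞ a) (hb : ContDiff ℝ ∞ b) (hc : ContDiff ℝ ∞ c) (hnL : n ≤ L) :
    IsBandLimited L fun x : EuclideanSpace ℝ (Fin 3) =>
      a (‖x‖ ^ 2) • gradient (fun z => ((ℓ z) ^ n).re) x +
        b (‖x‖ ^ 2) • (((ℓ x) ^ n).re • x) +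
        c (‖x‖ ^ 2) • cross x (gradient (fun z => ((ℓ z) ^ n).re) x) :=
  isBandLimited_threeLift ha hb hc (contDiff_re_clm_pow ℓ n) (laplacian_re_clm_pow ℓ hiso n)
    (fderiv_re_clm_pow_self ℓ n) hnL

/-- **The sectoral three-profile field is an `n`-fold azimuthal wave**: `J₃(J₃U) = −n²U` (the letter
of `Qlwave.IsAzimuthalWave n U`). [cite: BullardGellman1954] -/
theorem wave_sectoralAnsatz (h2 : ∀ y, ℓ (crossCLM (axis 2) y) = I * ℓ y)
    (ha : ContDiff ℝ ∞ a) (hb : ContDiff ℝ ∞ b) (hc : ContDiff ℝ ∞ c) (y : EuclideanSpace ℝ (Fin 3)) :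
    angGen 2 (angGen 2 fun x : EuclideanSpace ℝ (Fin 3) =>
      a (‖x‖ ^ 2) • gradient (fun z => ((ℓ z) ^ n).re) x +
        b (‖x‖ ^ 2) • (((ℓ x) ^ n).re • x) +
        c (‖x‖ ^ 2) • cross x (gradient (fun z => ((ℓ z) ^ n).re) x)) y =
      -(((n : ℝ) ^ 2) • (a (‖y‖ ^ 2) • gradient (fun z => ((ℓ z) ^ n).re) y +
        b (‖y‖ ^ 2) • (((ℓ y) ^ n).re • y) +
        c (‖y‖ ^ 2) • cross y (gradient (fun z => ((ℓ z) ^ n).re) y))) :=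
  wave_threeLift ha hb hc (contDiff_re_clm_pow ℓ n) (contDiff_im_clm_pow ℓ n)
    (scalarRot_two_re_clm_pow ℓ h2 n) (fun z => by rw [scalarRot_two_im_clm_pow ℓ h2 n z]) y

/-- **Below its fold the sectoral three-profile field is co-band-limited**: for `L < n` it is
`L²`-orthogonal to every compactly supported field band-limited of degree `≤ L` (letter
`IsCobandLimited L E`). [cite: BullardGellman1954] -/
theorem isCobandLimited_sectoralAnsatz (hiso : ∑ i : Fin 3, (ℓ (axis i)) ^ 2 = 0)
    (ha : ContDiff ℝ ∞ a) (hb : ContDiff ℝ ∞ b) (hc : ContDiff ℝ ∞ c) (hLn : L < n) :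
    IsCobandLimited L fun x : EuclideanSpace ℝ (Fin 3) =>
      a (‖x‖ ^ 2) • gradient (fun z => ((ℓ z) ^ n).re) x +
        b (‖x‖ ^ 2) • (((ℓ x) ^ n).re • x) +
        c (‖x‖ ^ 2) • cross x (gradient (fun z => ((ℓ z) ^ n).re) x) :=
  isCobandLimited_threeLift ha hb hc (contDiff_re_clm_pow ℓ n) (laplacian_re_clm_pow ℓ hiso n)
    (fderiv_re_clm_pow_self ℓ n) hLn

/-- **The sectoral three-profile field is divergence free under the poloidal ODE**
`2n a′(ρ) + 2ρ b′(ρ) + (n+3) b(ρ) = 0` (`ρ ≥ 0`) (letter `IsDivFree W`). [cite: BullardGellman1954] -/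
theorem isDivFree_sectoralAnsatz (hiso : ∑ i : Fin 3, (ℓ (axis i)) ^ 2 = 0)
    (ha : ContDiff ℝ ∞ a) (hb : ContDiff ℝ ∞ b) (hc : ContDiff ℝ ∞ c)
    (hODE : ∀ ρ : ℝ, 0 ≤ ρ → 2 * (n : ℝ) * deriv a ρ + 2 * ρ * deriv b ρ + ((n : ℝ) + 3) * b ρ = 0) :
    VectorCalculus.IsDivFree fun x : EuclideanSpace ℝ (Fin 3) =>
      a (‖x‖ ^ 2) • gradient (fun z => ((ℓ z) ^ n).re) x +
        b (‖x‖ ^ 2) • (((ℓ x) ^ n).re • x) +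
        c (‖x‖ ^ 2) • cross x (gradient (fun z => ((ℓ z) ^ n).re) x) :=
  isDivFree_threeLift ha hb hc (contDiff_re_clm_pow ℓ n) (laplacian_re_clm_pow ℓ hiso n)
    (fderiv_re_clm_pow_self ℓ n) hODE

/-- **The three laws of `ℓ(y) = y₀ + iy₁`**: isotropy `Σ_i ℓ(e_i)² = 1 + i² + 0 = 0`, the `K₂` law
`ℓ(e₂ × y) = iℓ(y)`, and `Σ_a ℓ(e_a × y)² = −ℓ(y)²`. [folklore] -/
theorem sectoral_functional_laws (hℓ : ∀ y, ℓ y = ((y 0 : ℝ) : ℂ) + I * ((y 1 : ℝ) : ℂ)) :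
    (∑ i : Fin 3, (ℓ (axis i)) ^ 2 = 0) ∧ (∀ y, ℓ (crossCLM (axis 2) y) = I * ℓ y) ∧
      ∀ y, ∑ a : Fin 3, (ℓ (crossCLM (axis a) y)) ^ 2 = -(ℓ y) ^ 2 := by
  refine ⟨?_, fun y => ?_, fun y => ?_⟩
  · simp only [Fin.sum_univ_three, hℓ, axis_apply]
    simp [sq]
  · rw [hℓ, hℓ, crossCLM_apply]
    apply Complex.ext <;> simp [cross, cross_apply, axis_apply]
  · simp only [Fin.sum_univ_three, hℓ, crossCLM_apply]
    apply Complex.ext <;> simp [cross, cross_apply, axis_apply, sq]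

/-- **The hypotheses are inhabited**: there is a real-linear `ℓ : ℝ³ → ℂ` (namely `y₀ + iy₁`) with
`Σ_i ℓ(e_i)² = 0`, `ℓ(e₂ × y) = iℓ(y)`, `Σ_a ℓ(e_a × y)² = −ℓ(y)²`, so the sectoral three-profile
class above is available on every rung with every smooth `a, b, c`. [folklore] -/
theorem exists_sectoralAnsatz_functional :
    ∃ ℓ : EuclideanSpace ℝ (Fin 3) →L[ℝ] ℂ,
      (∀ y, ℓ y = ((y 0 : ℝ) : ℂ) + I * ((y 1 : ℝ) : ℂ)) ∧ (∑ i : Fin 3, (ℓ (axis i)) ^ 2 = 0) ∧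
      (∀ y, ℓ (crossCLM (axis 2) y) = I * ℓ y) ∧
      ∀ y, ∑ a : Fin 3, (ℓ (crossCLM (axis a) y)) ^ 2 = -(ℓ y) ^ 2 := by
  obtain ⟨ℓ, hℓ, -, -⟩ := AngularGalerkinLadderSectoralToroidal.exists_sectoral_functional
  exact ⟨ℓ, hℓ, sectoral_functional_laws ℓ hℓ⟩

end Summit.NavierStokesRegularity.AngularGalerkinLadderSectoralWaveAnsatz

end
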